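import Summits.AtomisticToContinuum.HydrodynamicLimit.Theorems.AntiMazurCoboundariesKineticFluxLdDecaySelfTiltObjects
import Literature.Analysis.FluidPDE.HardSphereTiltWeight
import Literature.Analysis.Calculus.TiltedCGFIdentity
import HarnessLib

/-!
# The self-tilted edge-covariance identity (stub `stub_selfTiltIdentity`)

Crux `Summit.AtomisticToContinuum.HydrodynamicLimit.Theses.AntiMazurCoboundaries.KineticFluxLdDecay`
(stmt-AtomisticToContinuum-10967), line `self-tilted-edge-covariance`, registered stub
`stub_selfTiltIdentity : SelfTiltIdentity` (objects module
`…Theorems.AntiMazurCoboundariesKineticFluxLdDecaySelfTiltObjects`).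

For a hard-sphere flow `Φ` on `𝕋³`, a `Φ`-invariant probability law `μ` carried by the good set, a bounded
continuous observable `F`, a tilt rate `β ≠ 0` and a window `h`, with `J_u(z) = ∫₀ᵘ F(Φ_r z) dr`,
`W_u = e^{βJ_u}` (`tiltWeight`), `Z(u) = E_μ W_u`, `Nu(u) = E_μ[F W_u]`, `P(u) = E_μ[F∘Φ_u W_u]`,
`M(u) = E_μ[F∘Φ_u · F · W_u]`:

* `Z, Nu` are continuous; the right difference quotients give right derivatives `Z'₊ = βP` and `Nu'₊ = βM`
  (`HardSphereFlow.tendsto_slope_integral_mul_tilt`: pathwise right derivative of the tilt along the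
  right-continuous good orbits + dominated convergence), and ALSO `Z'₊ = βNu`
  (`HardSphereFlow.tendsto_slope_integral_tilt_of_invariant`: cocycle + invariance of `μ`), so `P = Nu`;
* `Z > 0`, `Z(0) = 1` (`stub_selfTiltObjects`), `M` bounded, hence the flow-free calculus
  `Literature.Analysis.Calculus.log_eq_of_hasDeriv_right` (FTC-2 from right derivatives for `log Z` and
  `Nu/Z`) gives `log Z(h) = βh E_μF + β² ∫₀ʰ∫₀ˢ (M/Z − (Nu/Z)²) = βh E_μF + β² ∫₀ʰ∫₀ˢ 𝒞_β(u) du ds`,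
  the edge covariance being `𝒞_β = M/Z − (P/Z)(Nu/Z)` (DemboZeitouni2010 §2.3;
  Jakšić–Pillet–Rey-Bellet arXiv:1009.3248).
-/

noncomputable section

open MeasureTheory Set Filter Topology
open scoped ENNReal

namespace Summit.AtomisticToContinuum.HydrodynamicLimit.Theorems.SelfTilt

open Literature.Analysis.FluidPDE (HardSphereFlow Config)

variable {ε : ℝ} {n : ℕ}

/-- The tilt weight, unfolded to the form used by `Literature.Analysis.FluidPDE.HardSphereTiltWeight`. -/
theorem tiltWeight_eq (Φ : TFlow ε n) (F : TPhase n → ℝ) (β u : ℝ) (z : TPhase n) :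
    tiltWeight Φ F β u z = Real.exp (β * ∫ r in (0 : ℝ)..u, F (Φ.flow r z)) := rfl

/-- **The self-tilted Green–Kubo identity in logarithmic form**: for `β ≠ 0` and `h ≥ 0`,
`log E_μ e^{βJ_h} = βh E_μF + β² ∫₀ʰ∫₀ˢ 𝒞_β(u) du ds`. -/
theorem log_integral_tiltWeight (Φ : TFlow ε n) (μ : Measure (TPhase n)) [IsProbabilityMeasure μ]
    (hinv : ∀ t, MeasurePreserving (Φ.flow t) μ μ) (hgood : μ Φ.goodᶜ = 0)
    {F : TPhase n → ℝ} (hFc : Continuous F) {C : ℝ} (hC : ∀ z, |F z| ≤ C) (hC0 : 0 ≤ C)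
    {β : ℝ} (hβ : β ≠ 0) {h : ℝ} (hh : 0 ≤ h) :
    Real.log (∫ z, tiltWeight Φ F β h z ∂μ) =
      β * h * (∫ z, F z ∂μ) + β ^ 2 * fejerInt Φ μ F β h := by
  have hFm := hFc.measurable
  -- everything in terms of the unfolded tilt `W u z = exp (β ∫₀ᵘ F (Φ_r z) dr)`
  simp only [fejerInt, edgeCov, tiltMean, tiltWeight_eq]
  obtain ⟨Z, hZ⟩ : ∃ Z : ℝ → ℝ, ∀ u, Z u = ∫ z, Real.exp (β * ∫ r in (0 : ℝ)..u, F (Φ.flow r z)) ∂μ :=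
    ⟨_, fun _ => rfl⟩
  obtain ⟨Nu, hNu⟩ : ∃ Nu : ℝ → ℝ,
      ∀ u, Nu u = ∫ z, F z * Real.exp (β * ∫ r in (0 : ℝ)..u, F (Φ.flow r z)) ∂μ := ⟨_, fun _ => rfl⟩
  obtain ⟨P, hP⟩ : ∃ P : ℝ → ℝ,
      ∀ u, P u = ∫ z, F (Φ.flow u z) * Real.exp (β * ∫ r in (0 : ℝ)..u, F (Φ.flow r z)) ∂μ :=
    ⟨_, fun _ => rfl⟩
  obtain ⟨M, hM⟩ : ∃ M : ℝ → ℝ,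
      ∀ u, M u = ∫ z, F (Φ.flow u z) * F z * Real.exp (β * ∫ r in (0 : ℝ)..u, F (Φ.flow r z)) ∂μ :=
    ⟨_, fun _ => rfl⟩
  simp only [← hZ, ← hNu, ← hP, ← hM]
  -- continuity, positivity, values at `0`
  have hZc : Continuous Z := by
    rw [show Z = _ from funext hZ]
    simpa only [one_mul] using Φ.continuous_integral_mul_tilt hgood hFm hC hC0
      (X := fun _ => (1 : ℝ)) aemeasurable_const (K := 1) (fun _ => by simp) β
  have hNuc : Continuous Nu := by
    rw [show Nu = _ from funext hNu]
    exact Φ.continuous_integral_mul_tilt hgood hFm hC hC0 hFm.aemeasurable hC β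
  have hpos : ∀ u, 0 < Z u := fun u => by
    rw [hZ]
    exact (Real.exp_pos _).trans_le
      (stub_selfTiltObjects ε n Φ μ inferInstance hgood F hFm C hC β u).1
  have hZ0 : Z 0 = 1 := by
    rw [hZ]
    simp
  have hNu0 : Nu 0 = ∫ z, F z ∂μ := by
    rw [hNu]
    simp
  -- the two decompositions of the right derivative of `Z`, and the right derivative of `Nu`
  have h2 : ∀ u, Tendsto (fun t => (t - u)⁻¹ * (Z t - Z u)) (𝓝[>] u) (𝓝 (β * P u)) := fun u => by
    have hl := Φ.tendsto_slope_integral_mul_tilt hgood hFc hC hC0 (X := fun _ => (1 : ℝ))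
      aemeasurable_const (K := 1) (fun _ => by simp) β u
    simp only [one_mul] at hl
    have e1 : ∫ z, Real.exp (β * ∫ r in (0 : ℝ)..u, F (Φ.flow r z)) * (β * F (Φ.flow u z)) ∂μ =
        β * P u := by
      rw [hP, ← integral_const_mul]
      exact integral_congr_ae (ae_of_all _ fun z => by ring)
    rw [e1] at hl
    simpa only [hZ] using hl
  have h3 : ∀ u, Tendsto (fun t => (t - u)⁻¹ * (Z t - Z u)) (𝓝[>] u) (𝓝 (β * Nu u)) := fun u => by
    have hl := Φ.tendsto_slope_integral_tilt_of_invariant hgood hinv hFc hC hC0 β u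
    have e2 : ∫ z, β * F z * Real.exp (β * ∫ r in (0 : ℝ)..u, F (Φ.flow r z)) ∂μ = β * Nu u := by
      rw [hNu, ← integral_const_mul]
      exact integral_congr_ae (ae_of_all _ fun z => by ring)
    rw [e2] at hl
    simpa only [hZ] using hl
  have hPN : ∀ u, P u = Nu u := fun u =>
    mul_left_cancel₀ hβ (tendsto_nhds_unique (h2 u) (h3 u))
  have hZd : ∀ u, HasDerivWithinAt Z (β * Nu u) (Ioi u) u := fun u => by
    refine (hasDerivWithinAt_iff_tendsto_slope' (s := Ioi u) (by simp)).2 ?_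
    rw [slope_fun_def_field]
    simpa only [div_eq_inv_mul] using h3 u
  have hNud : ∀ u, HasDerivWithinAt Nu (β * M u) (Ioi u) u := fun u => by
    refine (hasDerivWithinAt_iff_tendsto_slope' (s := Ioi u) (by simp)).2 ?_
    rw [slope_fun_def_field]
    have hl := Φ.tendsto_slope_integral_mul_tilt hgood hFc hC hC0 hFm.aemeasurable hC β u
    have e3 : ∫ z, F z * (Real.exp (β * ∫ r in (0 : ℝ)..u, F (Φ.flow r z)) * (β * F (Φ.flow u z))) ∂μ =
        β * M u := by
      rw [hM, ← integral_const_mul]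
      exact integral_congr_ae (ae_of_all _ fun z => by ring)
    rw [e3] at hl
    simpa only [hNu, div_eq_inv_mul] using hl
  -- `M` is bounded on `[0, h]`
  have hMb : ∃ K, ∀ u ∈ Icc 0 h, |M u| ≤ K := by
    refine ⟨C * C * Real.exp (|β| * (h * C)), fun u hu => ?_⟩
    rw [hM]
    have hb := norm_integral_le_of_norm_le_const (μ := μ)
      (f := fun z => F (Φ.flow u z) * F z * Real.exp (β * ∫ r in (0 : ℝ)..u, F (Φ.flow r z)))
      (C := C * C * Real.exp (|β| * (h * C))) (ae_of_all _ fun z => ?_)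
    · simpa only [Real.norm_eq_abs, probReal_univ, mul_one] using hb
    · rw [Real.norm_eq_abs, abs_mul, abs_mul, abs_of_pos (Real.exp_pos _)]
      have hu' : |u| ≤ h := by
        rw [abs_of_nonneg hu.1]
        exact hu.2
      refine mul_le_mul (mul_le_mul (hC _) (hC _) (abs_nonneg _) hC0)
        ((Φ.tilt_le hC β u z).2.trans (Real.exp_le_exp.2 ?_)) (Real.exp_pos _).le
        (mul_nonneg hC0 hC0)
      exact mul_le_mul_of_nonneg_left (mul_le_mul_of_nonneg_right hu' hC0) (abs_nonneg β)
  -- the flow-free calculus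
  have key := Literature.Analysis.Calculus.log_eq_of_hasDeriv_right hβ hh hZc hNuc hpos hZ0 hZd hNud hMb
  simp only [hPN]
  rw [← hNu0]
  exact key

/-- **Registered stub `stub_selfTiltIdentity` — the self-tilted edge-covariance identity.** For every
hard-sphere flow `Φ` on `𝕋³`, every `Φ`-invariant probability law `μ` carried by the good set, every bounded
continuous `F`, every real `β` and `h > 0`:
`∫⁻ e^{βJ_h} dμ = ofReal (exp (βh E_μF + β² ∫₀ʰ∫₀ˢ 𝒞_β(u) du ds))`. At `β = 0` both sides are `1`; for
`β ≠ 0` this is `log_integral_tiltWeight` in the `∫⁻ … ofReal` currency (`ofReal_integral_eq_lintegral_ofReal`,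
`Real.exp_log`, `Z > 0` by `stub_selfTiltObjects`). -/
theorem stub_selfTiltIdentity : SelfTiltIdentity := by
  intro ε n Φ μ hμ hinv hgood F hFc hFb β h hh
  rcases eq_or_ne β 0 with rfl | hβ
  · simp
  obtain ⟨C₀, hC₀⟩ := hFb
  have hC : ∀ z, |F z| ≤ max C₀ 0 := fun z => (hC₀ z).trans (le_max_left _ _)
  have hC0 : (0 : ℝ) ≤ max C₀ 0 := le_max_right _ _
  have hFm := hFc.measurable
  have hint : Integrable (tiltWeight Φ F β h) μ := integrable_tiltWeight Φ hgood hFm hC β h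
  have hZpos : 0 < ∫ z, tiltWeight Φ F β h z ∂μ :=
    (Real.exp_pos _).trans_le (stub_selfTiltObjects ε n Φ μ hμ hgood F hFm _ hC β h).1
  change ∫⁻ z, ENNReal.ofReal (tiltWeight Φ F β h z) ∂μ = _
  rw [← ofReal_integral_eq_lintegral_ofReal hint (ae_of_all _ fun z => (tiltWeight_pos Φ F β h z).le),
    ← log_integral_tiltWeight Φ μ hinv hgood hFc hC hC0 hβ hh.le, Real.exp_log hZpos]

end Summit.AtomisticToContinuum.HydrodynamicLimit.Theorems.SelfTilt

end
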